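import Literature.AlgebraicGeometry.Resolution.ResolutionOfComponents
import Literature.AlgebraicGeometry.Resolution.PrincipalizationToResolution
import Mathlib.AlgebraicGeometry.Morphisms.ClosedImmersion
import Mathlib.AlgebraicGeometry.Morphisms.Separated
import Mathlib.AlgebraicGeometry.IdealSheaf.IrreducibleComponent
import Mathlib.AlgebraicGeometry.Noetherian
import HarnessLib

/-!
# Components step for the crux `FrobeniusLadder.FRationalResolution` (line `Sketch`)

Stub `stub_components` of the skeleton `Sketch` for crux stmt-ResolutionOfSingularities-15317: a
`k`-scheme `X` of finite type all of whose local rings are integral domains has a resolution of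
singularities as soon as every integral open subscheme of `X` has one. This is the purely geometric
step of the composition (no tight closure enters).

Proof. `X` is Noetherian (finite type over a field), reduced (its stalks are domains), and has
finitely many irreducible components. Each point lies on exactly ONE irreducible component because
its local ring is a domain (`eq_of_mem_irreducibleComponents_of_isDomain_stalk`), so an irreducible
component `Z` is the complement of the (closed) union of the other components, i.e. `Z` is clopen
(`isOpen_of_mem_irreducibleComponents`). By `hasResolution_of_irreducibleComponents` it suffices to
resolve the reduced (integral) closed subscheme `X_Z = (vanishingIdeal Z).subscheme` on each
component `Z`; its inclusion `X_Z → X` is an OPEN immersion: it factors through the open subscheme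
`U = Z` of `X` by a morphism `l : X_Z → U` which is a closed immersion (`X_Z → X` is one, `U → X` is
separated), surjective (both ranges are `Z`), into the reduced scheme `U`, hence an isomorphism
(`isIso_of_isClosedImmersion_of_surjective`). So the hypothesis applies to `X_Z → X` directly.
-/

set_option linter.dupNamespace false

noncomputable section

open CategoryTheory AlgebraicGeometry TopologicalSpace Literature.AlgebraicGeometry.Resolution

namespace Summit.ResolutionOfSingularities.ResolutionOfSingularities.Theorems.FRationalResolution.Components

open Scheme.IdealSheafData

/-- In a Noetherian scheme all of whose local rings are domains, every irreducible component is
open: it is the complement of the union of the finitely many other components (Mathlib's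
`Scheme.irreducibleComponentOpen`), because each point lies on exactly one component
(`eq_of_mem_irreducibleComponents_of_isDomain_stalk`). -/
theorem isOpen_of_mem_irreducibleComponents {X : Scheme.{0}} [IsNoetherian X]
    (hdom : ∀ x : X, IsDomain (X.presheaf.stalk x)) {Z : Set X}
    (hZ : Z ∈ irreducibleComponents X) : IsOpen Z := by
  have hZeq : (X.irreducibleComponentOpen Z : Set X) = Z := by
    ext z
    simp only [Scheme.irreducibleComponentOpen, Opens.coe_mk, Set.mem_compl_iff, Set.mem_sUnion,
      Set.mem_sdiff, Set.mem_singleton_iff, not_exists, not_and, and_imp]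
    constructor
    · intro h
      by_contra hzZ
      exact h _ (irreducibleComponent_mem_irreducibleComponents z)
        (fun e => hzZ (e ▸ mem_irreducibleComponent)) mem_irreducibleComponent
    · intro hzZ D hD hDZ hzD
      haveI := hdom z
      exact hDZ (eq_of_mem_irreducibleComponents_of_isDomain_stalk z hD hZ hzD hzZ)
  rw [← hZeq]
  exact (X.irreducibleComponentOpen Z).2

/-- On a reduced scheme, the inclusion of the reduced closed subscheme `(vanishingIdeal Z).subscheme`
on a closed AND OPEN subset `Z` is an open immersion (it is isomorphic over `X` to the open
subscheme `Z`: the comparison morphism is a surjective closed immersion into a reduced scheme). -/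
theorem isOpenImmersion_subschemeι_vanishingIdeal {X : Scheme.{0}} [IsReduced X] (Z : Closeds X)
    (hopen : IsOpen (Z : Set X)) : IsOpenImmersion (vanishingIdeal Z).subschemeι := by
  let U : X.Opens := ⟨Z, hopen⟩
  have hrange : Set.range (vanishingIdeal Z).subschemeι ⊆ Set.range U.ι := by
    rw [range_subschemeι_vanishingIdeal, Scheme.Opens.range_ι]
    exact subset_rfl
  let l : (vanishingIdeal Z).subscheme ⟶ U := IsOpenImmersion.lift U.ι (vanishingIdeal Z).subschemeι hrange
  have hfac : l ≫ U.ι = (vanishingIdeal Z).subschemeι := IsOpenImmersion.lift_fac _ _ _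
  haveI : IsClosedImmersion (l ≫ U.ι) := by rw [hfac]; infer_instance
  haveI : IsClosedImmersion l := IsClosedImmersion.of_comp l U.ι
  haveI : Surjective l := by
    refine ⟨fun u => ?_⟩
    have hu : U.ι u ∈ Set.range (vanishingIdeal Z).subschemeι := by
      rw [range_subschemeι_vanishingIdeal, Scheme.Opens.ι_apply]
      exact u.2
    obtain ⟨s, hs⟩ := hu
    refine ⟨s, U.ι.isOpenEmbedding.injective ?_⟩
    rw [← Scheme.Hom.comp_apply, hfac, hs]
  haveI : IsIso l := isIso_of_isClosedImmersion_of_surjective l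
  rw [← hfac]
  infer_instance

/-- COMPONENTS: a `k`-scheme of finite type all of whose local rings are domains has a resolution of
singularities as soon as every integral open subscheme of it has one. (Its irreducible components are
clopen — `isOpen_of_mem_irreducibleComponents` — and finitely many; glue with
`hasResolution_of_irreducibleComponents`, the reduced closed subscheme on a clopen component being an
integral open subscheme, `isOpenImmersion_subschemeι_vanishingIdeal`.) -/
theorem stub_components (k : Type) [Field k] (X : Scheme.{0}) (f : X ⟶ Spec (.of k))
    [LocallyOfFiniteType f] [QuasiCompact f] (hdom : ∀ x : X, IsDomain (X.presheaf.stalk x))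
    (hres : ∀ (U : Scheme.{0}) (j : U ⟶ X), IsOpenImmersion j → IsIntegral U →
      Scheme.HasResolution U) :
    Scheme.HasResolution X := by
  haveI : IsLocallyNoetherian X := LocallyOfFiniteType.isLocallyNoetherian f
  haveI : CompactSpace X := QuasiCompact.compactSpace_of_compactSpace f
  haveI : IsNoetherian X := { }
  haveI : IsReduced X := by
    haveI : ∀ x : X, _root_.IsReduced (X.presheaf.stalk x) := fun x => by
      haveI := hdom x
      infer_instance
    exact isReduced_of_isReduced_stalk X
  refine hasResolution_of_irreducibleComponents X NoetherianSpace.finite_irreducibleComponents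
    fun Z hZ => ?_
  haveI := isOpenImmersion_subschemeι_vanishingIdeal Z (isOpen_of_mem_irreducibleComponents hdom hZ)
  exact hres _ (vanishingIdeal Z).subschemeι inferInstance
    (isIntegral_subscheme_of_mem_irreducibleComponents Z hZ)

end Summit.ResolutionOfSingularities.ResolutionOfSingularities.Theorems.FRationalResolution.Components

end
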